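import Summits.CriticalPhenomena.CardyFormulaZ2.Theorems.CardyMagicRigidityPinchResamplingDefsV4
import Summits.CriticalPhenomena.CardyFormulaZ2.Theorems.CardyMagicRigidityNestingRigidityExteriorConditioning
import Summits.CriticalPhenomena.CardyFormulaZ2.Theorems.CardyMagicRigidityNestingRigidityNeckCoarseStructure
import HarnessLib

/-!
# Coarse measurability in probability from an event-level approximation (reduction of stub S11 to a symmetric-difference bound)

Crux `Summit.CriticalPhenomena.CardyFormulaZ2.Theses.CardyMagicRigidity.NestingRigidity`
(stmt-CriticalPhenomena-4835), line `pinch-resampling` v4, helper of stub S11 `stub_neckHookupCoarseT : NeckHookupCoarseT`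
(`…PinchResamplingDefsV4`: the hook-up probability `g^𝕋_{x,s} = tHookProb x s` of the ball `Λ_s(x)` given its exterior
is, in probability on the selection event `TPinch x x s s`, within `b` of a function of the coarse blob datum `tCoarse`).
Brick B4 ("probabilistic summation shell") of the S11 brief, sorry-free and arm-free:

* §1 (`NeckCoarse.*`, generic for the product measure `sitePercolation V p`, interior coordinates `K`, finite ring `R`
  disjoint from `K`; shared with the `ℤ²` twin S12 up to the measure): **Markov over the cylinders of the ring.**  If an
  event `E` FACTORS through (the interior, a ring-measurable datum `σ`) — `η ∩ K = η' ∩ K → σ η = σ η' → (η ∈ E ↔ η' ∈ E)`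
  — then `G(σ(ω)) := P_ξ[(ξ ∩ K) ∪ (ω ∖ K) ∈ E]` IS a function of `σ(ω)`, and for every selection event `Sel` read on the
  ring, `P(Sel ∩ {b < |condProbOff K Hook − G ∘ σ|}) ≤ P(Sel ∩ (Hook ∆ E)) / b` (`inProb_of_symmDiff`, with the
  pointwise bound `|condProbOff K Hook − condProbOff K E| ≤ condProbOff K (Hook ∆ E)` and the finite-sum Markov inequality
  `measureReal_lt_condProbOff_le`: on each ring cylinder `C_ζ` the function `condProbOff K D` is the constant
  `P(D ∩ C_ζ)/P(C_ζ)`).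
* §2 (site `𝕋`): **`neckHookupCoarseT_of_approx` (registered anchor)** — `NeckHookupCoarseT` follows from: for every `b > 0`
  there is `L` such that in the scale window (`1 ≤ ℓ`, `s³ ℓ ≤ lam⁴`, `L · lam ≤ s`) there is an event `E` factoring
  through (the sites of `Λ_s(x)`, `tCoarse ℓ lam s x o`) with `P(TPinch ∩ (THook ∆ E)) ≤ b² · P(TPinch)`.  This is the
  exact interface between the measure theory of the stub and its combinatorial heart (brick B3, the deterministic
  inclusion `TPinch ∩ (THook ∆ Hook*) ⊆ ⋃ arm events` for a fuzzy-attachment event `Hook*`, and the arm sums needing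
  `α₄ > 1` on site `𝕋`): nothing in the remaining work mentions `condProbOff`, `∃ G` or outer measures any more.
* A concrete candidate `E` (the fuzzy hook-up `Hook*` through the big blobs, with its factorisation) is kept in the S11
  work file `S11_HookStar.lean` of the lead's folder (definitions; to be landed with brick B3).
-/

noncomputable section

namespace Summit.CriticalPhenomena.CardyFormulaZ2.Cruxes.NestingRigidity.PinchResampling

open MeasureTheory Set Literature.Probability.Percolation Literature.Probability.LatticeModels
open scoped symmDiff

namespace NeckCoarse

/-! ## §1 Generic: conditional probabilities of events that factor through a ring datum, and Markov over cylinders -/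

section Generic

variable {V : Type*}

/-- `|μ A − μ B| ≤ μ (A ∆ B)` for a finite measure (no measurability needed: outer subadditivity). -/
theorem abs_measureReal_sub_le_symmDiff {Ω : Type*} [MeasurableSpace Ω] (μ : Measure Ω) [IsFiniteMeasure μ]
    (A B : Set Ω) : |μ.real A - μ.real B| ≤ μ.real (A ∆ B) := by
  rw [abs_sub_le_iff]
  constructor
  · have h1 : μ.real A ≤ μ.real (B ∪ A ∆ B) :=
      measureReal_mono fun a ha ↦ by by_cases hb : a ∈ B <;> simp [mem_symmDiff, ha, hb]
    linarith [measureReal_union_le (μ := μ) B (A ∆ B)]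
  · have h1 : μ.real B ≤ μ.real (A ∪ A ∆ B) :=
      measureReal_mono fun a hb ↦ by by_cases ha : a ∈ A <;> simp [mem_symmDiff, ha, hb]
    linarith [measureReal_union_le (μ := μ) A (A ∆ B)]

/-- **Pointwise comparison of two conditional probabilities**: `|condProbOff K A − condProbOff K B| ≤ condProbOff K (A ∆ B)`. -/
theorem abs_condProbOff_sub_le (μ : Measure (Set V)) [IsFiniteMeasure μ] (K : Set V) (A B : Set (Set V)) (ω : Set V) :
    |condProbOff μ K A ω - condProbOff μ K B ω| ≤ condProbOff μ K (A ∆ B) ω := by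
  have h : {ξ : Set V | ξ ∩ K ∪ ω \ K ∈ A ∆ B} = {ξ | ξ ∩ K ∪ ω \ K ∈ A} ∆ {ξ | ξ ∩ K ∪ ω \ K ∈ B} := by
    ext ξ; simp [mem_symmDiff]
  simp only [condProbOff, h]
  exact abs_measureReal_sub_le_symmDiff μ _ _

/-- `condProbOff` is monotone in the event. -/
theorem condProbOff_mono (μ : Measure (Set V)) [IsFiniteMeasure μ] (K : Set V) {A B : Set (Set V)} (h : A ⊆ B)
    (ω : Set V) : condProbOff μ K A ω ≤ condProbOff μ K B ω :=
  measureReal_mono (fun _ hξ ↦ h hξ)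

/-- On an event `Sel` read OFF `K`, conditioning commutes with restriction to `Sel`: for `ω ∈ Sel`,
`condProbOff K A ω = condProbOff K (Sel ∩ A) ω`. -/
theorem condProbOff_eq_inter_of_mem (μ : Measure (Set V)) (K : Set V) {Sel : Set (Set V)} (hSel : DeterminedBy Sel Kᶜ)
    (A : Set (Set V)) {ω : Set V} (hω : ω ∈ Sel) : condProbOff μ K A ω = condProbOff μ K (Sel ∩ A) ω := by
  simp only [condProbOff]
  congr 1
  ext ξ
  simp only [mem_setOf_eq, mem_inter_iff, splice_mem_iff_of_determinedBy hSel, hω, true_and]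

/-- The splice `(ξ ∩ K) ∪ (ω ∖ K)` agrees with `ω` at every coordinate off `K`. -/
theorem mem_splice_iff_of_notMem {K : Set V} (ξ ω : Set V) {i : V} (hi : i ∉ K) : (i ∈ ξ ∩ K ∪ ω \ K ↔ i ∈ ω) := by
  simp [hi]

/-- **An event factoring through (interior, ring datum) has a conditional probability factoring through the datum.**
If `σ` reads only coordinates off `K` and `E`-membership depends only on `(η ∩ K, σ η)`, then
`condProbOff K E ω = condProbOff K E ω'` whenever `σ ω = σ ω'`. -/
theorem condProbOff_eq_of_factor (μ : Measure (Set V)) {K : Set V} {α : Type*} {σ : Set V → α}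
    (hσ : ∀ ω ω' : Set V, (∀ i ∉ K, (i ∈ ω ↔ i ∈ ω')) → σ ω = σ ω') {E : Set (Set V)}
    (hE : ∀ η η' : Set V, η ∩ K = η' ∩ K → σ η = σ η' → (η ∈ E ↔ η' ∈ E)) {ω ω' : Set V} (h : σ ω = σ ω') :
    condProbOff μ K E ω = condProbOff μ K E ω' := by
  simp only [condProbOff]
  congr 1
  ext ξ
  refine hE _ _ (by rw [splice_inter, splice_inter]) ?_
  rw [hσ (ξ ∩ K ∪ ω \ K) ω fun i hi ↦ mem_splice_iff_of_notMem ξ ω hi,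
    hσ (ξ ∩ K ∪ ω' \ K) ω' fun i hi ↦ mem_splice_iff_of_notMem ξ ω' hi, h]

/-- An event factoring through (interior `K`, a datum read on `R`) is determined by `K ∪ R`. -/
theorem determinedBy_of_factor {K R : Set V} {α : Type*} {σ : Set V → α}
    (hσ : ∀ ω ω' : Set V, (∀ i ∈ R, (i ∈ ω ↔ i ∈ ω')) → σ ω = σ ω') {E : Set (Set V)}
    (hE : ∀ η η' : Set V, η ∩ K = η' ∩ K → σ η = σ η' → (η ∈ E ↔ η' ∈ E)) : DeterminedBy E (K ∪ R) := by
  rw [determinedBy_iff]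
  intro η η' h
  refine hE η η' ?_ (hσ η η' fun i hi ↦ ?_)
  · rw [← inter_eq_self_of_subset_right (subset_union_left (s := K) (t := R)), ← inter_assoc, ← inter_assoc, h]
  · exact ⟨fun hη ↦ ((Set.ext_iff.1 h i).1 ⟨hη, Or.inr hi⟩).1, fun hη ↦ ((Set.ext_iff.1 h i).2 ⟨hη, Or.inr hi⟩).1⟩

/-- `condProbOff K D` of an event read on `K ∪ R` reads only the ring `R`. -/
theorem condProbOff_congr_of_agree (μ : Measure (Set V)) {K : Set V} {R : Set V} {D : Set (Set V)}
    (hD : DeterminedBy D (K ∪ R)) {ω ω' : Set V} (h : ∀ i ∈ R, (i ∈ ω ↔ i ∈ ω')) :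
    condProbOff μ K D ω = condProbOff μ K D ω' := by
  simp only [condProbOff]
  congr 1
  ext ξ
  exact (determinedBy_iff D _).1 hD _ _ (splice_inter_union_eq_of_agree ξ h)

/-- **Markov over the cylinders of a finite ring.**  For `D` measurable and read on `K ∪ R` (`R` a finite ring disjoint
from `K`) and any level `b`: `b · P{ω | b < condProbOff K D ω} ≤ P(D)` under the product measure `sitePercolation V p` — on the
cylinder `C_ζ` of the ring the function `condProbOff K D` is the constant `P(D_ζ)` with `P(D ∩ C_ζ) = P(D_ζ) P(C_ζ)`. -/
theorem measureReal_lt_condProbOff_le (p : unitInterval) {K : Set V} {R : Finset V} (hKR : Disjoint K ↑R)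
    {D : Set (Set V)} (hDm : MeasurableSet D) (hD : DeterminedBy D (K ∪ ↑R)) (b : ℝ) :
    b * (sitePercolation V p).real {ω | b < condProbOff (sitePercolation V p) K D ω} ≤ (sitePercolation V p).real D := by
  classical
  set μ := sitePercolation V p with hμ
  set h : Set V → ℝ := fun ω ↦ condProbOff μ K D ω with hh
  set C : Finset V → Set (Set V) := fun ζ ↦ localCylinder (↑R : Set V) (↑ζ : Set V) with hC
  have hCm : ∀ ζ, MeasurableSet (C ζ) := fun ζ ↦ measurableSet_localCylinder R.countable_toSet _
  -- the level set is read on the ring, hence measurable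
  have hBd : DeterminedBy {ω | b < h ω} ↑R := by
    rw [determinedBy_iff]
    intro ω ω' hωω'
    have key : ∀ i ∈ (↑R : Set V), (i ∈ ω ↔ i ∈ ω') := fun i hi ↦
      ⟨fun hω ↦ ((Set.ext_iff.1 hωω' i).1 ⟨hω, hi⟩).1, fun hω ↦ ((Set.ext_iff.1 hωω' i).2 ⟨hω, hi⟩).1⟩
    simp only [mem_setOf_eq, hh, condProbOff_congr_of_agree μ hD key]
  have hBm : MeasurableSet {ω | b < h ω} := hBd.measurableSet_of_finset
  -- `h` is constant on each cylinder
  have hconst : ∀ ζ : Finset V, ∀ ω ∈ C ζ, h ω = h ↑ζ := fun ζ ω hω ↦ condProbOff_congr_of_agree μ hD hω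
  -- `P(D ∩ C_ζ) = h(ζ) P(C_ζ)`
  have hDC : ∀ ζ : Finset V, μ.real (D ∩ C ζ) = h ↑ζ * μ.real (C ζ) := by
    intro ζ
    have hset : D ∩ C ζ = {ω | ω ∩ K ∪ (↑ζ : Set V) \ K ∈ D} ∩ C ζ := by
      ext ω
      simp only [mem_inter_iff, mem_setOf_eq, and_congr_left_iff]
      intro hω
      refine (determinedBy_iff D _).1 hD _ _ ?_
      have e := splice_inter_union_eq_of_agree (K := K) ω hω
      rwa [inter_union_sdiff] at e
    rw [hset]
    exact measureReal_inter_of_determinedBy p hKR (measurableSet_interiorSection hDm K _) (hCm ζ)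
      (determinedBy_interiorSection D K _) (determinedBy_localCylinder _ _)
  -- cylinderwise Markov
  have hcyl : ∀ ζ : Finset V, b * μ.real ({ω | b < h ω} ∩ C ζ) ≤ μ.real (D ∩ C ζ) := by
    intro ζ
    rw [hDC]
    by_cases hζ : b < h ↑ζ
    · have e : {ω | b < h ω} ∩ C ζ = C ζ := by
        ext ω
        simp only [mem_inter_iff, mem_setOf_eq, and_iff_right_iff_imp]
        intro hω
        rwa [hconst ζ ω hω]
      rw [e]
      exact mul_le_mul_of_nonneg_right hζ.le measureReal_nonneg
    · have e : {ω | b < h ω} ∩ C ζ = ∅ := by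
        ext ω
        simp only [mem_inter_iff, mem_setOf_eq, mem_empty_iff_false, iff_false, not_and]
        intro hω hωC
        rw [hconst ζ ω hωC] at hω
        exact hζ hω
      rw [e, measureReal_empty, mul_zero]
      exact mul_nonneg (condProbOff_mem_Icc μ K D _).1 measureReal_nonneg
  rw [measureReal_eq_sum_inter_localCylinder μ R hBm, measureReal_eq_sum_inter_localCylinder μ R hDm, Finset.mul_sum]
  exact Finset.sum_le_sum fun ζ _ ↦ hcyl ζ

/-- **Coarse measurability in probability from a symmetric-difference bound (generic).**  Product measure
`sitePercolation V p`; interior `K`, finite ring `R` disjoint from `K`; a selection event `Sel` read on the ring; a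
target event `Hook` read on `K ∪ R`; a datum `σ` read on the ring; an approximating event `E` whose membership depends
only on `(η ∩ K, σ η)`.  Then `G := condProbOff K E`, as a function of the datum, satisfies
`P(Sel ∩ {b < |condProbOff K Hook − G ∘ σ|}) ≤ P(Sel ∩ (Hook ∆ E)) / b`. -/
theorem inProb_of_symmDiff (p : unitInterval) {K : Set V} {R : Finset V} (hKR : Disjoint K ↑R)
    {Sel Hook E : Set (Set V)} (hSelm : MeasurableSet Sel) (hHookm : MeasurableSet Hook) (hEm : MeasurableSet E)
    (hSel : DeterminedBy Sel ↑R) (hHook : DeterminedBy Hook (K ∪ ↑R))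
    {α : Type*} (σ : Set V → α) (hσ : ∀ ω ω' : Set V, (∀ i ∈ (↑R : Set V), (i ∈ ω ↔ i ∈ ω')) → σ ω = σ ω')
    (hE : ∀ η η' : Set V, η ∩ K = η' ∩ K → σ η = σ η' → (η ∈ E ↔ η' ∈ E)) {b : ℝ} (hb : 0 < b) :
    ∃ G : α → ℝ, (sitePercolation V p).real (Sel ∩ {ω | b < |condProbOff (sitePercolation V p) K Hook ω - G (σ ω)|}) ≤
      (sitePercolation V p).real (Sel ∩ (Hook ∆ E)) / b := by
  classical
  set μ := sitePercolation V p with hμ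
  have hRK : (↑R : Set V) ⊆ Kᶜ := fun i hi hiK ↦ Set.disjoint_left.1 hKR hiK hi
  have hσ' : ∀ ω ω' : Set V, (∀ i ∉ K, (i ∈ ω ↔ i ∈ ω')) → σ ω = σ ω' :=
    fun ω ω' h ↦ hσ ω ω' fun i hi ↦ h i (hRK hi)
  -- the σ-measurable version of `condProbOff K E`
  let G : α → ℝ := fun d ↦ if hd : ∃ ω : Set V, σ ω = d then condProbOff μ K E hd.choose else 0
  have hG : ∀ ω : Set V, G (σ ω) = condProbOff μ K E ω := by
    intro ω
    have hd : ∃ ω' : Set V, σ ω' = σ ω := ⟨ω, rfl⟩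
    simp only [G, dif_pos hd]
    exact condProbOff_eq_of_factor μ hσ' hE hd.choose_spec
  refine ⟨G, ?_⟩
  set D : Set (Set V) := Sel ∩ (Hook ∆ E) with hDdef
  have hEd : DeterminedBy E (K ∪ ↑R) := determinedBy_of_factor hσ hE
  have hDd : DeterminedBy D (K ∪ ↑R) := by
    refine (hSel.mono subset_union_right).inter ?_
    rw [determinedBy_iff] at hHook hEd ⊢
    intro ω ω' h
    simp only [mem_symmDiff, hHook ω ω' h, hEd ω ω' h]
  have hDm : MeasurableSet D := hSelm.inter (hHookm.symmDiff hEm)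
  -- Step 1: the deviation event is contained in a level set of `condProbOff K D`
  have hsub : Sel ∩ {ω | b < |condProbOff μ K Hook ω - G (σ ω)|} ⊆ {ω | b < condProbOff μ K D ω} := by
    rintro ω ⟨hωS, hω⟩
    simp only [mem_setOf_eq] at hω ⊢
    rw [hG ω] at hω
    refine hω.trans_le ((abs_condProbOff_sub_le μ K Hook E ω).trans_eq ?_)
    exact condProbOff_eq_inter_of_mem μ K (hSel.mono hRK) _ hωS
  -- Step 2: Markov over the ring cylinders
  have hM := measureReal_lt_condProbOff_le p hKR hDm hDd b
  rw [le_div_iff₀ hb, mul_comm]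
  exact (mul_le_mul_of_nonneg_left (measureReal_mono hsub) hb.le).trans hM

end Generic

end NeckCoarse

/-! ## §2 Site `𝕋`: the stub from an event-level approximation of the hook-up -/

section SiteT

/-- The collar `Λ_{2s}(x) ∖ Λ_s(x)` as a `Finset`. -/
theorem exists_finset_collar (x : Site 2) (s : ℕ) :
    ∃ R : Finset (Site 2), (↑R : Set (Site 2)) = tBall x (2 * s) \ tBall x s :=
  have hfin : (tBall x (2 * s) \ tBall x s).Finite := (tBall_finite x (2 * s)).subset Set.sdiff_subset
  ⟨hfin.toFinset, hfin.coe_toFinset⟩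

/-- `tCoarse` reads only the collar, pointwise-agreement form of `tCoarse_congr` (`…NeckCoarseStructure`). -/
theorem tCoarse_congr_of_agree (ℓ lam s : ℕ) (x o : Site 2) {ω ω' : SiteConfig (Site 2)}
    (h : ∀ i ∈ tBall x (2 * s) \ tBall x s, (i ∈ ω ↔ i ∈ ω')) : tCoarse ℓ lam s x o ω = tCoarse ℓ lam s x o ω' :=
  tCoarse_congr ℓ lam s x o (Set.ext fun i ↦ ⟨fun hi ↦ ⟨(h i hi.2).1 hi.1, hi.2⟩, fun hi ↦ ⟨(h i hi.2).2 hi.1, hi.2⟩⟩)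

/-- **`NeckHookupCoarseT` from an event-level approximation (registered anchor; brick B4 of S11).**  Suppose that for every
`b > 0` there is a scale ratio `L` such that for all centres `x`, grid origins `o` and `ℓ, lam, s` in the window
(`1 ≤ ℓ`, `s³ ℓ ≤ lam⁴`, `L · lam ≤ s`) there is an event `E` whose membership depends only on the sites of the ball
`Λ_s(x)` and on the coarse datum `tCoarse ℓ lam s x o`, and which approximates the hook-up on the selection event:
`P(TPinch ∩ (THook ∆ E)) ≤ b² · P(TPinch)`.  Then `NeckHookupCoarseT` holds, with `G(σ) = P_ξ[E | σ]`. -/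
theorem neckHookupCoarseT_of_approx : (∀ b : ℝ, 0 < b → ∃ L : ℕ, ∀ (x o : Site 2) (ℓ lam s : ℕ), 1 ≤ ℓ → s ^ 3 * ℓ ≤ lam ^ 4 → L * lam ≤ s → ∃ E : Set (SiteConfig (Site 2)), (∀ η η' : SiteConfig (Site 2), η ∩ tBall x s = η' ∩ tBall x s → tCoarse ℓ lam s x o η = tCoarse ℓ lam s x o η' → (η ∈ E ↔ η' ∈ E)) ∧ (triSitePercolation half).real (TPinch x x s s ∩ symmDiff (THook x x s s) E) ≤ b ^ 2 * (triSitePercolation half).real (TPinch x x s s)) → NeckHookupCoarseT := by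
  intro h b hb
  obtain ⟨L, hL⟩ := h b hb
  refine ⟨L, fun x o ℓ lam s hℓ hw hs ↦ ?_⟩
  obtain ⟨E, hE, hbound⟩ := hL x o ℓ lam s hℓ hw hs
  obtain ⟨R, hR⟩ := exists_finset_collar x s
  have hKR : Disjoint (tBall x s) ↑R := by rw [hR]; exact disjoint_sdiff_right
  have hKuR : tBall x s ∪ ↑R = tBall x (2 * s) := by
    rw [hR, Set.union_sdiff_self, union_eq_right]
    intro v hv
    simp only [tBall, mem_setOf_eq] at hv ⊢
    push_cast; omega
  have hSel : DeterminedBy (TPinch x x s s) ↑R := by rw [hR]; exact tPinch_determinedBy x x s s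
  have hHook : DeterminedBy (THook x x s s) (tBall x s ∪ ↑R) := by rw [hKuR]; exact tHook_determinedBy x x s s
  have hσ : ∀ ω ω' : SiteConfig (Site 2), (∀ i ∈ (↑R : Set (Site 2)), (i ∈ ω ↔ i ∈ ω')) →
      tCoarse ℓ lam s x o ω = tCoarse ℓ lam s x o ω' := by
    rw [hR]; exact fun ω ω' hω ↦ tCoarse_congr_of_agree ℓ lam s x o hω
  have hEm : MeasurableSet E := by
    have hEd := NeckCoarse.determinedBy_of_factor hσ hE
    rw [hKuR] at hEd
    exact measurableSet_of_determinedBy_finite (tBall_finite x (2 * s)) hEd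
  obtain ⟨G, hG⟩ := NeckCoarse.inProb_of_symmDiff half hKR (measurableSet_tPinch x x s s) (measurableSet_tHook x x s s)
    hEm hSel hHook (tCoarse ℓ lam s x o) hσ hE hb
  refine ⟨G, hG.trans ?_⟩
  rw [div_le_iff₀ hb]
  calc (triSitePercolation half).real (TPinch x x s s ∩ symmDiff (THook x x s s) E)
      ≤ b ^ 2 * (triSitePercolation half).real (TPinch x x s s) := hbound
    _ = b * (triSitePercolation half).real (TPinch x x s s) * b := by ring

end SiteT


end Summit.CriticalPhenomena.CardyFormulaZ2.Cruxes.NestingRigidity.PinchResampling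

end
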